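import Mathlib.Analysis.SpecialFunctions.Pow.Real
import Literature.Analysis.FluidPDE.FiniteFourierModeEulerBeltrami

/-!
# Kishimoto–Yoneda, §4: transport around a triangle of non-interacting modes forces Beltrami

Support file for `FiniteFourierModeEuler` (N. Kishimoto, T. Yoneda, J. Math. Fluid Mech. 24
(2022) 74 = arXiv:2110.08039). This is the mechanism of the proof of **Proposition 4.7**
(and of Prop. 4.4 (iv)): if the coefficient vectors are transported by Prop. 2.2 along a closed
chain of pairwise non-interacting frequencies `n₁ → n₂ → ⋯ → n_p → n₁`, then `u_{n₁}` is an
eigenvector of the composed rotation `𝓡₁`, "and since the rotation angle is not an integral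
multiple of `π`, `u_{n₁}` is either `BV⁺` or `BV⁻`". We PROVE the closed-chain statement for
chains of length three, with the rotation-angle condition made ALGEBRAIC (no areas, no
Gauss–Bonnet):

* `exists_isBV_of_dot_self_eq_zero` / `IsBV.dot_self_eq_zero` (Lemma 1.2 (ii) in invariant form):
  a non-zero divergence-free `u` is a Beltrami vector at `n` iff it is ISOTROPIC for the
  `ℂ`-bilinear dot product, `u · u = 0` (`= |Re u|² - |Im u|² + 2i Re u · Im u`).
* `frame_change` (the elementary rotation of Lemma 4.6 at one vertex, unnormalised): passing at the
  vertex `v` from the frame of the plane `(p, v)` to the frame of the plane `(v, q)` multiplies the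
  frame coordinates by `[[c, τ], [-|v|² τ, c]] / |v × q|²`, `c = (p × v)·(v × q)`, `τ = [p, v, q]`.
* `dot_self_eq_zero_of_triangle` (**Prop. 4.7 for a 3-chain**): if `n, a, b` have
  `[n, a, b] ≠ 0`, the three pairs do not interact ((2.3)) and the three vectors are non-zero and
  divergence-free, then `|n| = |a| = |b|` (`norm_eq_of_triangle`) and, provided
  `Δ := |n|² + n·a + a·b + b·n ≠ 0`, `u_n · u_n = 0`, i.e. `u_n` is `BV^±` (`exists_isBV_of_triangle`).
  Here `Δ ≠ 0` is exactly "the rotation angle `Ω` of `𝓡₁` is not a multiple of `π`": the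
  composed frame matrix is `[[C, T], [-ρT, C]]` with
  `T = -[n,a,b] (ρ - n·a)(ρ - a·b)(ρ - b·n) Δ`, `ρ = |n|²` (`loop_T_eq`), and by the classical
  half-angle formula `tan(Ω/2) = [n̂,â,b̂] / (1 + n̂·â + â·b̂ + b̂·n̂)` this vanishes iff `Ω ∈ πℤ`.

## References

* [KishimotoYoneda2022] N. Kishimoto, T. Yoneda, J. Math. Fluid Mech. 24 (2022) 74 =
  arXiv:2110.08039, §1 Lemma 1.2, §4 Lemma 4.6, Prop. 4.4 (iv), Prop. 4.7 (proof).
-/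

noncomputable section

open Matrix

namespace Literature.Analysis.FluidPDE

namespace KY

/-! ### Isotropic divergence-free vectors are Beltrami vectors (Lemma 1.2 (ii)) -/

/-- The bilinear square of a frame vector: `(αp₁ + βk)·(αp₁ + βk) = |k|²(|n₁|²α² + β²)`.
[cite: KishimotoYoneda2022, §1 Lemma 1.2 (ii)] -/
theorem dot_self_frame₁ (n₁ n₂ : Fin 3 → ℝ) (α β : ℂ) :
    dot (α • cplx ((n₁ ⨯₃ n₂) ⨯₃ n₁) + β • cplx (n₁ ⨯₃ n₂))
        (α • cplx ((n₁ ⨯₃ n₂) ⨯₃ n₁) + β • cplx (n₁ ⨯₃ n₂))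
      = (((n₁ ⨯₃ n₂) ⬝ᵥ (n₁ ⨯₃ n₂) : ℝ) : ℂ) * ((((n₁ ⬝ᵥ n₁) : ℝ) : ℂ) * α ^ 2 + β ^ 2) := by
  simp only [dot_eq, real_dot_eq, cplx_apply, cross_apply, Pi.add_apply,
      Pi.smul_apply, smul_eq_mul, Matrix.cons_val_zero, Matrix.cons_val_one,
      Matrix.head_cons, Matrix.cons_val_two, Matrix.tail_cons]
  push_cast
  ring

/-- **Lemma 1.2 (ii), invariant form.** A non-zero divergence-free vector which is isotropic for
the bilinear dot product (`u·u = 0`, i.e. `|Re u| = |Im u|` and `Re u ⊥ Im u`) is a Beltrami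
vector at `n` for one of the two eigenvalues `±|n|`. [cite: KishimotoYoneda2022, §1 Lemma 1.2 (ii)] -/
theorem exists_isBV_of_dot_self_eq_zero {n : Fin 3 → ℝ} {u : Fin 3 → ℂ} (hn : n ≠ 0) (hne : u ≠ 0)
    (hdiv : dot (cplx n) u = 0) (hiso : dot u u = 0) : ∃ μ : ℝ, IsBV μ n u := by
  -- an auxiliary independent frequency
  have key : ∃ n₂ : Fin 3 → ℝ, n ⨯₃ n₂ ≠ 0 := by
    by_contra hall
    simp only [not_exists, not_not] at hall
    have h0 := hall ![1, 0, 0]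
    have h1 := hall ![0, 1, 0]
    simp only [cross_apply, Matrix.cons_val_zero, Matrix.cons_val_one, Matrix.head_cons,
      Matrix.cons_val_two, Matrix.tail_cons, mul_one, mul_zero, sub_zero, zero_sub,
      Matrix.cons_eq_zero_iff, neg_eq_zero, Matrix.zero_empty, and_true, true_and] at h0 h1
    apply hn; ext i; fin_cases i
    · exact h1.2
    · exact h0.2
    · exact h0.1
  obtain ⟨n₂, hk⟩ := key
  obtain ⟨α, β, hu⟩ := exists_frame₁ hk hdiv
  have hK : (((n ⨯₃ n₂) ⬝ᵥ (n ⨯₃ n₂) : ℝ) : ℂ) ≠ 0 := by exact_mod_cast real_dot_self_ne_zero hk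
  rw [hu, dot_self_frame₁] at hiso
  have hq : (((n ⬝ᵥ n : ℝ)) : ℂ) * α ^ 2 + β ^ 2 = 0 := (mul_eq_zero.1 hiso).resolve_left hK
  -- `β² = -(|n|² α²) = (i |n| α)²`
  set r : ℝ := Real.sqrt (n ⬝ᵥ n) with hr
  have hN : 0 ≤ n ⬝ᵥ n := by
    rw [real_dot_eq]; nlinarith [sq_nonneg (n 0), sq_nonneg (n 1), sq_nonneg (n 2)]
  have hr2 : r ^ 2 = n ⬝ᵥ n := by rw [hr, Real.sq_sqrt hN]
  have hsq : β ^ 2 = (Complex.I * r * α) ^ 2 := by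
    have : ((n ⬝ᵥ n : ℝ) : ℂ) = (r : ℂ) ^ 2 := by rw [← hr2]; push_cast; ring
    rw [this] at hq
    linear_combination hq - ((r:ℂ)^2 * α ^ 2) * Complex.I_sq
  have hα : α ≠ 0 := by
    rintro rfl
    have hβ : β = 0 := by simpa using hsq
    exact hne (by rw [hu, hβ]; simp)
  rcases sq_eq_sq_iff_eq_or_eq_neg.1 hsq with h | h
  · exact ⟨r, (isBV_frame_iff₁ hk r hu).2 ⟨hα, h, hr2⟩⟩
  · refine ⟨-r, (isBV_frame_iff₁ hk (-r) hu).2 ⟨hα, ?_, by rw [neg_sq, hr2]⟩⟩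
    rw [h]; push_cast; ring

/-- Conversely a Beltrami vector is isotropic. [cite: KishimotoYoneda2022, §1 Lemma 1.2 (ii)] -/
theorem IsBV.dot_self_eq_zero {μ : ℝ} {n : Fin 3 → ℝ} {u : Fin 3 → ℂ} (h : IsBV μ n u) (hn : n ≠ 0) :
    dot u u = 0 := by
  have key : ∃ n₂ : Fin 3 → ℝ, n ⨯₃ n₂ ≠ 0 := by
    by_contra hall
    simp only [not_exists, not_not] at hall
    have h0 := hall ![1, 0, 0]
    have h1 := hall ![0, 1, 0]
    simp only [cross_apply, Matrix.cons_val_zero, Matrix.cons_val_one, Matrix.head_cons,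
      Matrix.cons_val_two, Matrix.tail_cons, mul_one, mul_zero, sub_zero, zero_sub,
      Matrix.cons_eq_zero_iff, neg_eq_zero, Matrix.zero_empty, and_true, true_and] at h0 h1
    apply hn; ext i; fin_cases i
    · exact h1.2
    · exact h0.2
    · exact h0.1
  obtain ⟨n₂, hk⟩ := key
  obtain ⟨α, β, hu⟩ := exists_frame₁ hk h.dot_eq_zero
  obtain ⟨-, hβ, hμ⟩ := (isBV_frame_iff₁ hk μ hu).1 h
  rw [hu, dot_self_frame₁, hβ, ← hμ]
  push_cast
  linear_combination ((((n ⨯₃ n₂) ⬝ᵥ (n ⨯₃ n₂) : ℝ) : ℂ) * (μ : ℂ) ^ 2 * α ^ 2) * Complex.I_sq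

/-! ### Changing the frame at a vertex (the elementary rotation of Lemma 4.6) -/

/-- **Frame change at a vertex** (unnormalised form of the rotation by `2θ_j` in Lemma 4.6): a
vector given in the frame `(k_in × v, k_in)` of the plane `(p, v)` (`k_in = p × v`) is, in the
frame `(k_out × v, k_out)` of the plane `(v, q)` (`k_out = v × q`),
`|k_out|² w = (c x + τ y)(k_out × v) + (-τ|v|² x + c y) k_out` with `c = k_in · k_out`,
`τ = [p, v, q]`. [cite: KishimotoYoneda2022, §4 Lemma 4.6 (proof)] -/
theorem frame_change (p v q : Fin 3 → ℝ) (x y : ℂ) :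
    ((((v ⨯₃ q) ⬝ᵥ (v ⨯₃ q)) : ℝ) : ℂ) • (x • cplx ((p ⨯₃ v) ⨯₃ v) + y • cplx (p ⨯₃ v))
      = ((((p ⨯₃ v) ⬝ᵥ (v ⨯₃ q) : ℝ) : ℂ) * x + ((p ⬝ᵥ (v ⨯₃ q) : ℝ) : ℂ) * y) •
          cplx ((v ⨯₃ q) ⨯₃ v)
        + (-((p ⬝ᵥ (v ⨯₃ q) : ℝ) : ℂ) * ((v ⬝ᵥ v : ℝ) : ℂ) * x
            + (((p ⨯₃ v) ⬝ᵥ (v ⨯₃ q) : ℝ) : ℂ) * y) • cplx (v ⨯₃ q) := by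
  rw [vec3_eq_iff]
  simp only [real_dot_eq, cplx_apply, cross_apply, Pi.add_apply, Pi.smul_apply, smul_eq_mul,
      Matrix.cons_val_zero, Matrix.cons_val_one, Matrix.head_cons, Matrix.cons_val_two,
      Matrix.tail_cons]
  push_cast
  refine ⟨?_, ?_, ?_⟩ <;> ring

/-- The square of a triple product is the Gram determinant. [folklore] -/
theorem triple_product_sq (n a b : Fin 3 → ℝ) :
    (n ⬝ᵥ (a ⨯₃ b)) ^ 2 = (n ⬝ᵥ n) * (a ⬝ᵥ a) * (b ⬝ᵥ b) + 2 * (n ⬝ᵥ a) * (a ⬝ᵥ b) * (b ⬝ᵥ n)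
      - (n ⬝ᵥ n) * (a ⬝ᵥ b) ^ 2 - (a ⬝ᵥ a) * (b ⬝ᵥ n) ^ 2 - (b ⬝ᵥ b) * (n ⬝ᵥ a) ^ 2 := by
  simp only [real_dot_eq, cross_apply, Matrix.cons_val_zero, Matrix.cons_val_one, Matrix.head_cons,
      Matrix.cons_val_two, Matrix.tail_cons]
  ring

/-- Cyclic invariance of the triple product. [folklore] -/
theorem triple_product_cyclic (n a b : Fin 3 → ℝ) : a ⬝ᵥ (b ⨯₃ n) = n ⬝ᵥ (a ⨯₃ b) :=
  (triple_product_permutation n a b).symm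

/-- `|v - w|² = 0` forces `v = w`; for equal lengths, `v · w = |v|²` forces `v = w`. [folklore] -/
theorem eq_of_dot_eq_of_norm_eq {v w : Fin 3 → ℝ} (h1 : v ⬝ᵥ v = w ⬝ᵥ w) (h2 : v ⬝ᵥ w = v ⬝ᵥ v) :
    v = w := by
  have : (v - w) ⬝ᵥ (v - w) = 0 := by
    simp only [sub_dotProduct, dotProduct_sub, dotProduct_comm w v]
    linarith
  exact sub_eq_zero.1 (dotProduct_self_eq_zero.1 this)


/-! ### The algebra of a closed 3-chain -/

/-- The composed frame matrix of a 3-chain: if the frame coordinates are multiplied successively by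
`γ₁`, `[[c_a, τ], [-ρτ, c_a]]/K₂`, `γ₂`, `[[c_b, τ], [-ρτ, c_b]]/K₃`, `γ₃`, `[[c_n, τ], [-ρτ, c_n]]/K₁`
and return to their initial values, then `T (ρx² + y²) = 0` with
`T = τ (c_a c_b + c_b c_n + c_n c_a - ρτ²)` the off-diagonal entry of the product (the three
matrices commute: they are `c + τε` with `ε² = -ρ`). [cite: KishimotoYoneda2022, §4 proof of Prop. 4.7] -/
theorem loop_algebra {x y xa ya x₂ y₂ xb yb x₃ y₃ xn yn γ₁ γ₂ γ₃ cA cB cN τ ρ K₁ K₂ K₃ : ℂ}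
    (hK₁ : K₁ ≠ 0) (hK₂ : K₂ ≠ 0) (hK₃ : K₃ ≠ 0)
    (hxa : xa = γ₁ * x) (hya : ya = γ₁ * y)
    (hx₂ : x₂ = (cA * xa + τ * ya) / K₂) (hy₂ : y₂ = (-τ * ρ * xa + cA * ya) / K₂)
    (hxb : xb = γ₂ * x₂) (hyb : yb = γ₂ * y₂)
    (hx₃ : x₃ = (cB * xb + τ * yb) / K₃) (hy₃ : y₃ = (-τ * ρ * xb + cB * yb) / K₃)
    (hxn : xn = γ₃ * x₃) (hyn : yn = γ₃ * y₃)
    (hx₄ : x = (cN * xn + τ * yn) / K₁) (hy₄ : y = (-τ * ρ * xn + cN * yn) / K₁) :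
    γ₁ * γ₂ * γ₃ * (τ * (cA * cB + cB * cN + cN * cA - ρ * τ ^ 2)) * (ρ * x ^ 2 + y ^ 2) = 0 := by
  have key : x * ((-τ * ρ * xn + cN * yn) / K₁) - y * ((cN * xn + τ * yn) / K₁) = 0 := by
    rw [← hx₄, ← hy₄]; ring
  subst hxn hyn hx₃ hy₃ hxb hyb hx₂ hy₂ hxa hya
  field_simp at key
  linear_combination (-1 : ℂ) * key

/-- The symmetric-function identity behind "the rotation angle is not a multiple of `π`":
with `c_a = XY - Zρ`, `c_b = YZ - Xρ`, `c_n = ZX - Yρ` (the pairwise products of the normals of a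
triangle with `|n|² = |a|² = |b|² = ρ`, `X = n·a`, `Y = a·b`, `Z = b·n`) and
`τ² = ρ³ + 2XYZ - ρ(X² + Y² + Z²)` (Gram determinant),
`c_a c_b + c_b c_n + c_n c_a - ρτ² = -(ρ - X)(ρ - Y)(ρ - Z)(ρ + X + Y + Z)`. [folklore] -/
theorem loop_T_identity (X Y Z ρ τsq : ℝ) (hτ : τsq = ρ ^ 3 + 2 * X * Y * Z - ρ * (X ^ 2 + Y ^ 2 + Z ^ 2)) :
    (X * Y - Z * ρ) * (Y * Z - X * ρ) + (Y * Z - X * ρ) * (Z * X - Y * ρ)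
        + (Z * X - Y * ρ) * (X * Y - Z * ρ) - ρ * τsq
      = -((ρ - X) * (ρ - Y) * (ρ - Z) * (ρ + X + Y + Z)) := by
  rw [hτ]; ring

/-- From `K • w = A • P + B • Q` to `w = (A/K) • P + (B/K) • Q`. [folklore] -/
theorem eq_div_smul_of_smul_eq {K : ℂ} (hK : K ≠ 0) {w P Q : Fin 3 → ℂ} {A B : ℂ}
    (h : K • w = A • P + B • Q) : w = (A / K) • P + (B / K) • Q := by
  apply smul_right_injective (Fin 3 → ℂ) hK
  dsimp only
  rw [h, smul_add, smul_smul, smul_smul, mul_div_cancel₀ _ hK, mul_div_cancel₀ _ hK]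

/-- The triple product as a dot product with the first normal. [folklore] -/
theorem triple_product_eq_cross_dot (n a b : Fin 3 → ℝ) : n ⬝ᵥ (a ⨯₃ b) = (n ⨯₃ a) ⬝ᵥ b := by
  simp only [real_dot_eq, cross_apply, Matrix.cons_val_zero, Matrix.cons_val_one, Matrix.head_cons,
      Matrix.cons_val_two, Matrix.tail_cons]
  ring

/-! ### Around a triangle of non-interacting modes (Prop. 4.7 for a 3-chain) -/

section Triangle

variable {n a b : Fin 3 → ℝ} {un ua ub : Fin 3 → ℂ}

/-- **Proposition 4.7 for a 3-chain, metric part.** If `[n, a, b] ≠ 0`, the three pairs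
`(n, a)`, `(a, b)`, `(b, n)` do not interact and the three coefficient vectors are non-zero and
divergence-free, then `|n| = |a| = |b|` (Prop. 2.2: case (ii) cannot occur at two consecutive
pairs of a non-degenerate triangle, and case (iii) forces equal lengths).
[cite: KishimotoYoneda2022, §2 Prop. 2.2 and §4 proof of Prop. 4.4] -/
theorem norm_eq_of_triangle (hτ : n ⬝ᵥ (a ⨯₃ b) ≠ 0) (hun : un ≠ 0) (hua : ua ≠ 0) (hub : ub ≠ 0)
    (hdn : dot (cplx n) un = 0) (hda : dot (cplx a) ua = 0) (hdb : dot (cplx b) ub = 0)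
    (h₁ : NonInteracting n a un ua) (h₂ : NonInteracting a b ua ub) (h₃ : NonInteracting b n ub un) :
    a ⬝ᵥ a = n ⬝ᵥ n ∧ b ⬝ᵥ b = n ⬝ᵥ n := by
  -- the three normals
  have hk₁ : n ⨯₃ a ≠ 0 := by
    intro h; apply hτ; rw [triple_product_eq_cross_dot, h, zero_dotProduct]
  have hk₂ : a ⨯₃ b ≠ 0 := by
    intro h; apply hτ; rw [h, dotProduct_zero]
  have hk₃ : b ⨯₃ n ≠ 0 := by
    intro h; apply hτ; rw [← triple_product_cyclic, h, dotProduct_zero]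
  have hτ' : ((n ⬝ᵥ (a ⨯₃ b) : ℝ) : ℂ) ≠ 0 := by exact_mod_cast hτ
  have hK₁ : (((n ⨯₃ a) ⬝ᵥ (n ⨯₃ a) : ℝ) : ℂ) ≠ 0 := by exact_mod_cast real_dot_self_ne_zero hk₁
  have hK₂ : (((a ⨯₃ b) ⬝ᵥ (a ⨯₃ b) : ℝ) : ℂ) ≠ 0 := by exact_mod_cast real_dot_self_ne_zero hk₂
  have hK₃ : (((b ⨯₃ n) ⬝ᵥ (b ⨯₃ n) : ℝ) : ℂ) ≠ 0 := by exact_mod_cast real_dot_self_ne_zero hk₃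
  -- leg `n → a`
  obtain ⟨x, y, hux⟩ := exists_frame₁ hk₁ hdn
  obtain ⟨xa, ya, hua'⟩ := exists_frame₂ hk₁ hda
  obtain ⟨⟨γ₁, hγ₁, hxa, hya⟩, hN₁⟩ := nonInteracting_transport hk₁ hux hua' hun hua h₁
  -- frame change at `a`
  have hfa := frame_change n a b xa ya
  rw [← hua'] at hfa
  have hua2 := eq_div_smul_of_smul_eq hK₂ hfa
  -- leg `a → b`
  obtain ⟨xb, yb, hub'⟩ := exists_frame₂ hk₂ hdb
  obtain ⟨⟨γ₂, hγ₂, hxb, hyb⟩, hN₂⟩ := nonInteracting_transport hk₂ hua2 hub' hua hub h₂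
  -- frame change at `b`
  have hfb := frame_change a b n xb yb
  rw [← hub'] at hfb
  have hub2 := eq_div_smul_of_smul_eq hK₃ hfb
  -- leg `b → n`
  obtain ⟨xn, yn, hun'⟩ := exists_frame₂ hk₃ hdn
  obtain ⟨⟨γ₃, hγ₃, hxn, hyn⟩, hN₃⟩ := nonInteracting_transport hk₃ hub2 hun' hub hun h₃
  -- frame change at `n` and comparison with the initial coordinates
  have hfn := frame_change b n a xn yn
  rw [← hun'] at hfn
  have hun2 := eq_div_smul_of_smul_eq hK₁ hfn
  rw [hux, frame_eq_iff₁ hk₁] at hun2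
  obtain ⟨hx₄, hy₄⟩ := hun2
  rw [triple_product_cyclic n a b] at hxn hyn hN₃
  rw [triple_product_cyclic a b n, triple_product_cyclic n a b] at hx₄ hy₄
  -- non-vanishing bookkeeping
  have hy0 : x = 0 → y ≠ 0 := by
    rintro rfl rfl; exact hun (by rw [hux]; simp)
  by_cases hx : x = 0
  · -- then the second coordinate at `a` in the new frame is `τ γ₁ y / K₂ ≠ 0`
    have hy := hy0 hx
    have hx₂ : (((n ⨯₃ a) ⬝ᵥ (a ⨯₃ b) : ℝ) : ℂ) * xa + ((n ⬝ᵥ (a ⨯₃ b) : ℝ) : ℂ) * ya ≠ 0 := by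
      rw [hxa, hya, hx]; simp only [mul_zero, zero_add]
      exact mul_ne_zero hτ' (mul_ne_zero hγ₁ hy)
    have hab : a ⬝ᵥ a = b ⬝ᵥ b := hN₂ (div_ne_zero hx₂ hK₂)
    -- and at `b`: if the new first coordinate vanished, `un` would vanish
    by_cases hx₃ : (((a ⨯₃ b) ⬝ᵥ (b ⨯₃ n) : ℝ) : ℂ) * xb + ((n ⬝ᵥ (a ⨯₃ b) : ℝ) : ℂ) * yb = 0
    · exfalso
      have hxn0 : xn = 0 := by rw [hxn, hx₃]; simp
      have hyn0 : yn = 0 := by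
        have := hx₄
        rw [hx, hxn0] at this
        simp only [mul_zero, zero_add] at this
        rcases div_eq_zero_iff.1 this.symm with h | h
        · exact (mul_eq_zero.1 h).resolve_left hτ'
        · exact absurd h hK₁
      exact hun (by rw [hun', hxn0, hyn0]; simp)
    · have hbn : b ⬝ᵥ b = n ⬝ᵥ n := hN₃ (div_ne_zero hx₃ hK₃)
      exact ⟨hab.trans hbn, hbn⟩
  · have hna : n ⬝ᵥ n = a ⬝ᵥ a := hN₁ hx
    by_cases hx₂ : (((n ⨯₃ a) ⬝ᵥ (a ⨯₃ b) : ℝ) : ℂ) * xa + ((n ⬝ᵥ (a ⨯₃ b) : ℝ) : ℂ) * ya = 0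
    · -- then at `b` the first new coordinate is `τ γ₂ y₂ ≠ 0`
      have hxb0 : xb = 0 := by rw [hxb, hx₂]; simp
      have hyb0 : yb ≠ 0 := by
        intro h0; exact hub (by rw [hub', hxb0, h0]; simp)
      have hx₃ : (((a ⨯₃ b) ⬝ᵥ (b ⨯₃ n) : ℝ) : ℂ) * xb + ((n ⬝ᵥ (a ⨯₃ b) : ℝ) : ℂ) * yb ≠ 0 := by
        rw [hxb0]; simp only [mul_zero, zero_add]; exact mul_ne_zero hτ' hyb0
      have hbn : b ⬝ᵥ b = n ⬝ᵥ n := hN₃ (div_ne_zero hx₃ hK₃)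
      exact ⟨hna.symm, hbn⟩
    · have hab : a ⬝ᵥ a = b ⬝ᵥ b := hN₂ (div_ne_zero hx₂ hK₂)
      exact ⟨hna.symm, (hna.trans hab).symm⟩


/-- **Proposition 4.7 for a 3-chain.** Under the hypotheses of `norm_eq_of_triangle` and the
angle condition `|n|² + n·a + a·b + b·n ≠ 0` (the holonomy angle of the chain is not a multiple
of `π`), the coefficient vector at `n` is isotropic: `u_n · u_n = 0`.
[cite: KishimotoYoneda2022, §4 Prop. 4.7 (proof: "`u_{n₁}(t₀)` is an eigenvector of the rotation operator `𝓡₁`")] -/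
theorem dot_self_eq_zero_of_triangle (hτ : n ⬝ᵥ (a ⨯₃ b) ≠ 0)
    (hD : n ⬝ᵥ n + n ⬝ᵥ a + a ⬝ᵥ b + b ⬝ᵥ n ≠ 0)
    (hun : un ≠ 0) (hua : ua ≠ 0) (hub : ub ≠ 0)
    (hdn : dot (cplx n) un = 0) (hda : dot (cplx a) ua = 0) (hdb : dot (cplx b) ub = 0)
    (h₁ : NonInteracting n a un ua) (h₂ : NonInteracting a b ua ub) (h₃ : NonInteracting b n ub un) :
    dot un un = 0 := by
  obtain ⟨hNa, hNb⟩ := norm_eq_of_triangle hτ hun hua hub hdn hda hdb h₁ h₂ h₃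
  have hk₁ : n ⨯₃ a ≠ 0 := by
    intro h; apply hτ; rw [triple_product_eq_cross_dot, h, zero_dotProduct]
  have hk₂ : a ⨯₃ b ≠ 0 := by
    intro h; apply hτ; rw [h, dotProduct_zero]
  have hk₃ : b ⨯₃ n ≠ 0 := by
    intro h; apply hτ; rw [← triple_product_cyclic, h, dotProduct_zero]
  have hτ' : ((n ⬝ᵥ (a ⨯₃ b) : ℝ) : ℂ) ≠ 0 := by exact_mod_cast hτ
  have hK₁ : (((n ⨯₃ a) ⬝ᵥ (n ⨯₃ a) : ℝ) : ℂ) ≠ 0 := by exact_mod_cast real_dot_self_ne_zero hk₁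
  have hK₂ : (((a ⨯₃ b) ⬝ᵥ (a ⨯₃ b) : ℝ) : ℂ) ≠ 0 := by exact_mod_cast real_dot_self_ne_zero hk₂
  have hK₃ : (((b ⨯₃ n) ⬝ᵥ (b ⨯₃ n) : ℝ) : ℂ) ≠ 0 := by exact_mod_cast real_dot_self_ne_zero hk₃
  -- the chain, as in `norm_eq_of_triangle`
  obtain ⟨x, y, hux⟩ := exists_frame₁ hk₁ hdn
  obtain ⟨xa, ya, hua'⟩ := exists_frame₂ hk₁ hda
  obtain ⟨⟨γ₁, hγ₁, hxa, hya⟩, -⟩ := nonInteracting_transport hk₁ hux hua' hun hua h₁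
  have hfa := frame_change n a b xa ya
  rw [← hua'] at hfa
  have hua2 := eq_div_smul_of_smul_eq hK₂ hfa
  obtain ⟨xb, yb, hub'⟩ := exists_frame₂ hk₂ hdb
  obtain ⟨⟨γ₂, hγ₂, hxb, hyb⟩, -⟩ := nonInteracting_transport hk₂ hua2 hub' hua hub h₂
  have hfb := frame_change a b n xb yb
  rw [← hub'] at hfb
  have hub2 := eq_div_smul_of_smul_eq hK₃ hfb
  obtain ⟨xn, yn, hun'⟩ := exists_frame₂ hk₃ hdn
  obtain ⟨⟨γ₃, hγ₃, hxn, hyn⟩, -⟩ := nonInteracting_transport hk₃ hub2 hun' hub hun h₃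
  have hfn := frame_change b n a xn yn
  rw [← hun'] at hfn
  have hun2 := eq_div_smul_of_smul_eq hK₁ hfn
  rw [hux, frame_eq_iff₁ hk₁] at hun2
  obtain ⟨hx₄, hy₄⟩ := hun2
  rw [triple_product_cyclic n a b] at hxn hyn
  rw [triple_product_cyclic a b n, triple_product_cyclic n a b] at hx₄ hy₄
  rw [hNa] at hyb
  rw [hNb] at hyn
  -- the loop algebra: `γ₁γ₂γ₃ · T · (ρ x² + y²) = 0`
  have halg := loop_algebra hK₁ hK₂ hK₃ hxa hya rfl rfl hxb hyb rfl rfl hxn hyn hx₄ hy₄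
  -- `T ≠ 0`
  have hT0 : (n ⨯₃ a) ⬝ᵥ (a ⨯₃ b) * ((a ⨯₃ b) ⬝ᵥ (b ⨯₃ n))
      + (a ⨯₃ b) ⬝ᵥ (b ⨯₃ n) * ((b ⨯₃ n) ⬝ᵥ (n ⨯₃ a))
      + (b ⨯₃ n) ⬝ᵥ (n ⨯₃ a) * ((n ⨯₃ a) ⬝ᵥ (a ⨯₃ b)) - (n ⬝ᵥ n) * (n ⬝ᵥ (a ⨯₃ b)) ^ 2
      = -((n ⬝ᵥ n - n ⬝ᵥ a) * (n ⬝ᵥ n - a ⬝ᵥ b) * (n ⬝ᵥ n - b ⬝ᵥ n)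
          * (n ⬝ᵥ n + n ⬝ᵥ a + a ⬝ᵥ b + b ⬝ᵥ n)) := by
    rw [cross_dot_cross, cross_dot_cross, cross_dot_cross, triple_product_sq, hNa, hNb]
    simp only [dotProduct_comm n b, dotProduct_comm b a, dotProduct_comm a n]
    ring
  have hT : (n ⬝ᵥ (a ⨯₃ b)) * ((n ⨯₃ a) ⬝ᵥ (a ⨯₃ b) * ((a ⨯₃ b) ⬝ᵥ (b ⨯₃ n))
      + (a ⨯₃ b) ⬝ᵥ (b ⨯₃ n) * ((b ⨯₃ n) ⬝ᵥ (n ⨯₃ a))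
      + (b ⨯₃ n) ⬝ᵥ (n ⨯₃ a) * ((n ⨯₃ a) ⬝ᵥ (a ⨯₃ b)) - (n ⬝ᵥ n) * (n ⬝ᵥ (a ⨯₃ b)) ^ 2) ≠ 0 := by
    rw [hT0]
    refine mul_ne_zero hτ (neg_ne_zero.2 ?_)
    have hXa : n ⬝ᵥ n - n ⬝ᵥ a ≠ 0 := by
      intro h
      have : n = a := eq_of_dot_eq_of_norm_eq hNa.symm (by linarith)
      exact hk₁ (by rw [this, cross_self])
    have hYb : n ⬝ᵥ n - a ⬝ᵥ b ≠ 0 := by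
      intro h
      have : a = b := eq_of_dot_eq_of_norm_eq (hNa.trans hNb.symm) (by linarith)
      exact hk₂ (by rw [this, cross_self])
    have hZn : n ⬝ᵥ n - b ⬝ᵥ n ≠ 0 := by
      intro h
      have : b = n := eq_of_dot_eq_of_norm_eq hNb (by linarith)
      exact hk₃ (by rw [this, cross_self])
    exact mul_ne_zero (mul_ne_zero (mul_ne_zero hXa hYb) hZn) hD
  have hT' : (((n ⬝ᵥ (a ⨯₃ b)) * ((n ⨯₃ a) ⬝ᵥ (a ⨯₃ b) * ((a ⨯₃ b) ⬝ᵥ (b ⨯₃ n))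
      + (a ⨯₃ b) ⬝ᵥ (b ⨯₃ n) * ((b ⨯₃ n) ⬝ᵥ (n ⨯₃ a))
      + (b ⨯₃ n) ⬝ᵥ (n ⨯₃ a) * ((n ⨯₃ a) ⬝ᵥ (a ⨯₃ b)) - (n ⬝ᵥ n) * (n ⬝ᵥ (a ⨯₃ b)) ^ 2) : ℝ) : ℂ)
      ≠ 0 := by exact_mod_cast hT
  push_cast at hT'
  have hq : ((n ⬝ᵥ n : ℝ) : ℂ) * x ^ 2 + y ^ 2 = 0 :=
    (mul_eq_zero.1 halg).resolve_left (mul_ne_zero (mul_ne_zero (mul_ne_zero hγ₁ hγ₂) hγ₃) hT')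
  rw [hux, dot_self_frame₁, hq, mul_zero]

/-- **Proposition 4.7 for a 3-chain, Beltrami form**: under the same hypotheses `u_n` is `BV^±`.
[cite: KishimotoYoneda2022, §4 Prop. 4.7] -/
theorem exists_isBV_of_triangle (hτ : n ⬝ᵥ (a ⨯₃ b) ≠ 0)
    (hD : n ⬝ᵥ n + n ⬝ᵥ a + a ⬝ᵥ b + b ⬝ᵥ n ≠ 0)
    (hun : un ≠ 0) (hua : ua ≠ 0) (hub : ub ≠ 0)
    (hdn : dot (cplx n) un = 0) (hda : dot (cplx a) ua = 0) (hdb : dot (cplx b) ub = 0)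
    (h₁ : NonInteracting n a un ua) (h₂ : NonInteracting a b ua ub) (h₃ : NonInteracting b n ub un) :
    ∃ μ : ℝ, IsBV μ n un := by
  have hn : n ≠ 0 := by
    rintro rfl; apply hτ; simp
  exact exists_isBV_of_dot_self_eq_zero hn hun hdn
    (dot_self_eq_zero_of_triangle hτ hD hun hua hub hdn hda hdb h₁ h₂ h₃)

end Triangle

end KY

end Literature.Analysis.FluidPDE
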